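import Mathlib
import Literature.Computability.FineGrained.MonotoneOV
import Literature.Computability.Complexity.MonotoneNechiporuk
import Literature.Computability.Complexity.FormulaComposition
import HarnessLib

/-!
# Proof of the `Ω(n² d)` monotone formula lower bound for `¬OV` (fine-grained.S25, formula part)

Discharges `Literature.Computability.FineGrained.monotone_formula_notOV_lower_bound`
(`MonotoneOV.lean`): there are `c > 0`, `c₀ ≥ 1` with
`c · n² · d ≤ formulaSizeOver monotoneBasis (notOVFn n d)` for all large `n` and all
`d ≥ c₀ log n`. We take `c = 1/32`, `c₀ = 8`, `n ≥ 4`. (The circuit part of fine-grained.S25,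
`monotone_circuit_notOV_lower_bound`, is discharged in the sibling file `MonotoneOVProofs.lean` by
the approximation method; the two proofs share nothing beyond `notOVFn`.)

The source (T. Choudhury, N. Limaye, K. Sreenivasaiah, S. Srinivasan, *New and Improved Concrete
Lower Bounds for Orthogonal Vectors*, arXiv:2607.23799, Thm. 25(1) with Lemma 26 and Nechiporuk's
Thm. 24) proves `L(Int_{n,d}) = Ω(n² d)` for formulas over the full binary basis when
`d ≥ c log n`; the vendored fact is the monotone-basis consequence, and the proof here follows the
printed architecture inside the monotone basis:

1. **Nechiporuk's counting lemma** for formulas over `{∧₂, ∨₂}` in the straight-line model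
   (`Circuit.prod_subfnMeasure_eval_le`, file `Complexity/MonotoneNechiporuk.lean`):
   `∏_blocks ψ ≤ 3 ^ (2 · size + 1)`.
2. **Many subfunctions on a row block** (the paper's Lemma 26, with an explicit antichain code in
   place of the middle layer `H_{d/2}`): fixing all rows `a_i (i ≠ i₀)` to `1^d` and row `b_j` to the
   code word of the pair `(j, D j)` — the balanced code `l ↦ 2l + bit` of the binary digits of `j`
   on the first `2L` coordinates and of a data word `D j ∈ {0,1}^M` on the next `2M` — the
   restriction of `¬OV_{n,d}` to the block `a_{i₀}` is `a ↦ ⋀ⱼ [a ∩ code(j, D j) ≠ ∅]`, and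
   `D ↦` (this restriction) is injective (`NotOV.rowRestrict_injective`: evaluate at the complement
   of `code(j₀, w)`; code words are pairwise incomparable), giving `ψ ≥ 2^{M n}` per block
   (`NotOV.pow_le_subfnMeasure_row`), hence `M n² ≤ 4 · size + 2` (`NotOV.mul_sq_le_size`).
3. **A monotone formula for `¬OV` exists** (`NotOV.exists_formula`, via
   `Complexity/FormulaComposition.lean`), so `formulaSizeOver monotoneBasis` is attained.
4. Arithmetic: with `L = ⌊log₂ n⌋ + 1`, `M = ⌊d/2⌋ - L`, `d ≥ 8 ⌊log₂ n⌋`, `n ≥ 4` one has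
   `2L + 2M ≤ d`, `d ≤ 4M`, so `n² d ≤ 32 · size` (`NotOV.sq_mul_le_formulaSizeOver`).

## References

* [arXiv260723799] Choudhury–Limaye–Sreenivasaiah–Srinivasan 2026, §5: Thm. 24 (Nechiporuk),
  Thm. 25(1), Lemma 26 (PDF pp. 16–18).
* [Jukna2012] S. Jukna, *Boolean Function Complexity* (2012), Thm. 6.16.
-/

namespace Literature.Computability.FineGrained

open Filter Finset Complexity Cryptography

namespace NotOV

/-! ### `¬OV` unfolded -/

/-- `¬OV_{n,d}(A, B) = 1` iff every `a_i` meets every `b_j` (cf. the `AreOrthogonal` form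
`MonotoneOV.notOVFn_eq_true_iff` of the sibling file `MonotoneOVProofs.lean`). [cite: arXiv260723799, Def. 3] -/
theorem notOVFn_eq_true_iff (n d : ℕ) (x : Fin 2 × Fin n × Fin d → Bool) :
    notOVFn n d x = true ↔ ∀ i j : Fin n, ∃ t : Fin d, x (0, i, t) = true ∧ x (1, j, t) = true := by
  simp [notOVFn, ovFn, OVInstance.HasOrthogonalPair, OVInstance.ofBits, AreOrthogonal]

/-! ### A monotone formula for `¬OV` -/

/-- The obvious monotone formula `⋀ᵢ ⋀ⱼ ⋁ₜ (a_{i,t} ∧ b_{j,t})` for `¬OV_{n'+1, d'+1}`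
(arXiv:2607.23799, after Thm. 6: "OV has a simple Boolean formula of size `O(n² d)`"). [cite: arXiv260723799, §1 (after Thm. 6)] -/
def formula (n' d' : ℕ) : Circuit (Fin 2 × Fin (n' + 1) × Fin (d' + 1)) :=
  Circuit.bigAnd n' fun i => Circuit.bigAnd n' fun j => Circuit.bigOr d' fun t =>
    Circuit.binop (GateFn.and 2).2 (Circuit.input (0, i, t)) (Circuit.input (1, j, t))

/-- The formula is over `{∧₂, ∨₂}`, is a (clean) formula, and computes `¬OV`. [cite: arXiv260723799, §1 (after Thm. 6)] -/
theorem formula_spec (n' d' : ℕ) :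
    (formula n' d').IsOver monotoneBasis ∧ (formula n' d').IsFormula ∧
      (formula n' d').Computes (notOVFn (n' + 1) (d' + 1)) := by
  refine ⟨?_, ?_, ?_⟩
  · refine Circuit.isOver_bigAnd Circuit.and_two_mem_monotoneBasis _ _ fun i => ?_
    refine Circuit.isOver_bigAnd Circuit.and_two_mem_monotoneBasis _ _ fun j => ?_
    refine Circuit.isOver_bigOr Circuit.or_two_mem_monotoneBasis _ _ fun t => ?_
    exact Circuit.isOver_binop Circuit.and_two_mem_monotoneBasis (Circuit.isOver_input _ _)
      (Circuit.isOver_input _ _)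
  · refine (Circuit.isFormula_bigAnd _ _ fun i => ?_).1
    refine Circuit.isFormula_bigAnd _ _ fun j => ?_
    refine Circuit.isFormula_bigOr _ _ fun t => ?_
    exact Circuit.isFormula_binop _ (Circuit.isFormula_input _).1 (Circuit.isFormula_input _).2
      (Circuit.isFormula_input _).1 (Circuit.isFormula_input _).2
  · intro x
    rw [Bool.eq_iff_iff, notOVFn_eq_true_iff]
    simp [formula, Circuit.eval_bigAnd, Circuit.eval_bigOr, Circuit.eval_binop]

/-- For `n, d ≥ 1`, `¬OV_{n,d}` is computed by some formula over the monotone basis, so that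
`formulaSizeOver monotoneBasis (notOVFn n d)` is an attained minimum. [cite: arXiv260723799, §1 (after Thm. 6)] -/
theorem exists_formula {n d : ℕ} (hn : 1 ≤ n) (hd : 1 ≤ d) :
    ∃ C : Circuit (Fin 2 × Fin n × Fin d),
      C.IsOver monotoneBasis ∧ C.IsFormula ∧ C.Computes (notOVFn n d) := by
  obtain _ | n' := n
  · omega
  obtain _ | d' := d
  · omega
  exact ⟨formula n' d', formula_spec n' d'⟩

/-! ### Balanced codes -/

/-- `(2l + b) / 2 = l` for a bit `b`. [folklore] -/
theorem two_mul_add_toNat_div (l : ℕ) (b : Bool) : (2 * l + b.toNat) / 2 = l := by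
  have := Bool.toNat_le b
  omega

/-- `(2l + b) mod 2 = b` for a bit `b`. [folklore] -/
theorem two_mul_add_toNat_mod (l : ℕ) (b : Bool) : ((2 * l + b.toNat) % 2 == 1) = b := by
  cases b
  · simp
  · simp only [Bool.toNat_true]
    have : (2 * l + 1) % 2 = 1 := by omega
    simp [this]

/-- **The code bit at coordinate `t` of the pair (index `j`, data word `w`)**: the first `2L`
coordinates carry the balanced code `l ↦ 2l + bit_l(j)` of the binary digits of `j`, the next `2M`
coordinates the balanced code `e ↦ 2L + 2e + w(e)` of `w`; all code words have `L + M` ones, so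
they form an antichain (the rôle of the middle layer `H_{d/2}` in Lemma 26 of the source). [cite: arXiv260723799, Lemma 26] -/
def codeBit (L M : ℕ) (j : ℕ) (w : ℕ → Bool) (t : ℕ) : Bool :=
  if t < 2 * L then j.testBit (t / 2) == (t % 2 == 1)
  else if t < 2 * L + 2 * M then w ((t - 2 * L) / 2) == (t % 2 == 1)
  else false

/-- The index part of a code word: coordinate `2l + bit_l(j)` is set. [folklore] -/
theorem codeBit_index {L : ℕ} (M : ℕ) (j : ℕ) (w : ℕ → Bool) {l : ℕ} (hl : l < L) :
    codeBit L M j w (2 * l + (j.testBit l).toNat) = true := by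
  have hb := Bool.toNat_le (j.testBit l)
  unfold codeBit
  rw [if_pos (by omega), two_mul_add_toNat_div, two_mul_add_toNat_mod]
  simp

/-- The data part of a code word: coordinate `2L + 2e + w(e)` is set. [folklore] -/
theorem codeBit_data (L : ℕ) {M : ℕ} (j : ℕ) (w : ℕ → Bool) {e : ℕ} (he : e < M) :
    codeBit L M j w (2 * L + (2 * e + (w e).toNat)) = true := by
  have hb := Bool.toNat_le (w e)
  have ht : 2 * L + (2 * e + (w e).toNat) = 2 * (L + e) + (w e).toNat := by ring
  unfold codeBit
  rw [if_neg (by omega), if_pos (by omega),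
    show 2 * L + (2 * e + (w e).toNat) - 2 * L = 2 * e + (w e).toNat by omega,
    two_mul_add_toNat_div, ht, two_mul_add_toNat_mod]
  simp

/-- **Code words are incomparable**: if `code(j, v) ⊆ code(j₀, w)` inside `[0, d)` (with
`2L + 2M ≤ d`, `j, j₀ < 2^L`) then `j = j₀` and `v = w` on `[0, M)`. [cite: arXiv260723799, Lemma 26] -/
theorem eq_of_codeBit_imp {L M d : ℕ} (hLM : 2 * L + 2 * M ≤ d) {j j₀ : ℕ} (hj : j < 2 ^ L)
    (hj₀ : j₀ < 2 ^ L) {v w : ℕ → Bool}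
    (H : ∀ t < d, codeBit L M j v t = true → codeBit L M j₀ w t = true) :
    j = j₀ ∧ ∀ e < M, v e = w e := by
  constructor
  · apply Nat.eq_of_testBit_eq
    intro l
    by_cases hl : l < L
    · have hb := Bool.toNat_le (j.testBit l)
      have h := H _ (by omega) (codeBit_index M j v hl)
      unfold codeBit at h
      rw [if_pos (by omega), two_mul_add_toNat_div, two_mul_add_toNat_mod] at h
      have h' : j₀.testBit l = j.testBit l := by simpa using h
      exact h'.symm
    · have h2 : 2 ^ L ≤ 2 ^ l := Nat.pow_le_pow_right two_pos (not_lt.1 hl)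
      rw [Nat.testBit_lt_two_pow (lt_of_lt_of_le hj h2),
        Nat.testBit_lt_two_pow (lt_of_lt_of_le hj₀ h2)]
  · intro e he
    have hb := Bool.toNat_le (v e)
    have h := H _ (by omega) (codeBit_data L j v he)
    have ht : 2 * L + (2 * e + (v e).toNat) = 2 * (L + e) + (v e).toNat := by ring
    unfold codeBit at h
    rw [if_neg (by omega), if_pos (by omega),
      show 2 * L + (2 * e + (v e).toNat) - 2 * L = 2 * e + (v e).toNat by omega,
      two_mul_add_toNat_div, ht, two_mul_add_toNat_mod] at h
    have h' : w e = v e := by simpa using h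
    exact h'.symm

/-! ### The injective family of restrictions of `¬OV` to a row block -/

variable {n d : ℕ}

/-- Extension of a data word `w ∈ {0,1}^M` by zeros. [folklore] -/
def wext {M : ℕ} (w : Fin M → Bool) : ℕ → Bool := fun e => if h : e < M then w ⟨e, h⟩ else false

/-- The row blocks: variable `a_{i,t}` lies in block `i`, the `b`-variables in none. [cite: arXiv260723799, proof of Thm. 25] -/
def rowBlk : Fin 2 × Fin n × Fin d → Option (Fin n) := fun v => if v.1 = 0 then some v.2.1 else none

/-- The assignment outside the block `a_{i₀}` attached to the data table `D`: all rows `a_i` are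
`1^d` (the values on the block itself are ignored by `subfnRestrict`), and row `b_j` is the code
word of `(j, D j)` (Lemma 26 of the source: "set all the vectors in `A` other than `a₁` to `1⃗`, and
set each `bᵢ` to a distinct vector from `H_{d/2}`"). [cite: arXiv260723799, Lemma 26] -/
def rowAssign (L M : ℕ) (D : Fin n → Fin M → Bool) : Fin 2 × Fin n × Fin d → Bool :=
  fun v => if v.1 = 0 then true else codeBit L M v.2.1 (wext (D v.2.1)) v.2.2

/-- The test point: row `a_{i₀}` (indeed every row) is the complement of the code word of
`(j₀, w)`. [cite: arXiv260723799, Lemma 26] -/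
def testPt (L M : ℕ) (j₀ : ℕ) (w : ℕ → Bool) : Fin 2 × Fin n × Fin d → Bool :=
  fun v => !codeBit L M j₀ w v.2.2

/-- **The restriction of `¬OV` to the block `a_{i₀}` under `rowAssign D`** is
`a ↦ ⋀ⱼ [a meets code(j, D j)]` (the other rows `a_i = 1⃗` meet every nonempty code word).
[cite: arXiv260723799, Lemma 26] -/
theorem rowRestrict_eq_true_iff {L M : ℕ} (hL : 0 < L) (h2L : 2 * L ≤ d)
    (D : Fin n → Fin M → Bool) (i₀ : Fin n) (x : Fin 2 × Fin n × Fin d → Bool) :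
    subfnRestrict {v | rowBlk v = some i₀} (rowAssign L M D) (notOVFn n d) x = true ↔
      ∀ j : Fin n, ∃ t : Fin d, x (0, i₀, t) = true ∧
        codeBit L M j (wext (D j)) t = true := by
  rw [subfnRestrict_apply, notOVFn_eq_true_iff]
  have hmemA : ∀ (i : Fin n) (t : Fin d),
      ((0, i, t) : Fin 2 × Fin n × Fin d) ∈ {v | rowBlk v = some i₀} ↔ i = i₀ := by
    intro i t
    simp [rowBlk]
  have hmemB : ∀ (j : Fin n) (t : Fin d),
      ((1, j, t) : Fin 2 × Fin n × Fin d) ∉ {v | rowBlk v = some i₀} := by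
    intro j t
    simp [rowBlk]
  have hnonempty : ∀ j : Fin n, ∃ t : Fin d, codeBit L M j (wext (D j)) t = true := by
    intro j
    have hb := Bool.toNat_le ((j : ℕ).testBit 0)
    refine ⟨⟨2 * 0 + ((j : ℕ).testBit 0).toNat, by omega⟩, ?_⟩
    exact codeBit_index M j (wext (D j)) hL
  simp only [hmemA, hmemB, if_false, rowAssign, Fin.isValue, one_ne_zero, if_true]
  constructor
  · intro h j
    obtain ⟨t, ht⟩ := h i₀ j
    rw [if_pos rfl] at ht
    exact ⟨t, ht⟩
  · intro h i j
    by_cases hi : i = i₀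
    · subst hi
      obtain ⟨t, ht⟩ := h j
      exact ⟨t, by rw [if_pos rfl]; exact ht⟩
    · obtain ⟨t, ht⟩ := hnonempty j
      exact ⟨t, by rw [if_neg hi]; exact ⟨rfl, ht⟩⟩

/-- **At the test point** `x_{j₀,w}` the restriction attached to `D` vanishes iff `D j₀ = w`
(code words are pairwise incomparable). [cite: arXiv260723799, Lemma 26] -/
theorem rowRestrict_testPt_eq_false_iff {L M : ℕ} (hL : 0 < L) (hLM : 2 * L + 2 * M ≤ d)
    (hnL : n < 2 ^ L) (D : Fin n → Fin M → Bool) (i₀ j₀ : Fin n) (w : Fin M → Bool) :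
    subfnRestrict {v | rowBlk v = some i₀} (rowAssign L M D) (notOVFn n d)
        (testPt L M j₀ (wext w)) = false ↔ D j₀ = w := by
  rw [← Bool.not_eq_true, rowRestrict_eq_true_iff hL (by omega) D i₀]
  simp only [testPt, Bool.not_eq_true', not_forall, not_exists, not_and]
  constructor
  · rintro ⟨j, hj⟩
    -- `code(j, D j) ⊆ code(j₀, w)` inside `[0, d)`
    have H : ∀ t < d, codeBit L M j (wext (D j)) t = true → codeBit L M j₀ (wext w) t = true := by
      intro t ht h
      by_contra h'
      exact absurd h (by simpa using hj ⟨t, ht⟩ (by simpa using h'))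
    obtain ⟨hjj, hvw⟩ := eq_of_codeBit_imp hLM (lt_trans j.isLt hnL) (lt_trans j₀.isLt hnL) H
    have : j = j₀ := Fin.ext hjj
    subst this
    funext e
    have := hvw e e.isLt
    simpa [wext] using this
  · rintro rfl
    exact ⟨j₀, fun t ht => by simpa using ht⟩

/-- **Injectivity** of `D ↦ (¬OV restricted to block a_{i₀} under rowAssign D)`
(distinct data tables give distinct subfunctions). [cite: arXiv260723799, Lemma 26] -/
theorem rowRestrict_injective {L M : ℕ} (hL : 0 < L) (hLM : 2 * L + 2 * M ≤ d)
    (hnL : n < 2 ^ L) (i₀ : Fin n) :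
    Function.Injective fun D : Fin n → Fin M → Bool =>
      subfnRestrict {v | rowBlk v = some i₀} (rowAssign L M D) (notOVFn n d) := by
  intro D D' h
  funext j₀
  have h1 := (rowRestrict_testPt_eq_false_iff hL hLM hnL D i₀ j₀ (D j₀)).2 rfl
  have h2 : subfnRestrict {v | rowBlk v = some i₀} (rowAssign L M D') (notOVFn n d)
      (testPt L M j₀ (wext (D j₀))) = false := by
    rw [← h1]
    exact (congrFun h _).symm
  exact ((rowRestrict_testPt_eq_false_iff hL hLM hnL D' i₀ j₀ (D j₀)).1 h2).symm

/-- **Many subfunctions per row block** (the source's Lemma 26, lower bound, with the explicit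
code): `ψ_{a_{i₀}}(¬OV_{n,d}) ≥ 2^{M n}`. [cite: arXiv260723799, Lemma 26] -/
theorem pow_le_subfnMeasure_row {L M : ℕ} (hL : 0 < L) (hLM : 2 * L + 2 * M ≤ d)
    (hnL : n < 2 ^ L) (h2 : 2 < 2 ^ (M * n)) (i₀ : Fin n) :
    2 ^ (M * n) ≤ subfnMeasure {v | rowBlk v = some i₀} (notOVFn n d) := by
  have hcard : Fintype.card (Fin n → Fin M → Bool) = 2 ^ (M * n) := by
    simp only [Fintype.card_fun, Fintype.card_bool, Fintype.card_fin]
    rw [pow_mul]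
  rw [← hcard]
  exact card_le_subfnMeasure_of_injective (fun D => rowAssign L M D)
    (rowRestrict_injective hL hLM hnL i₀) (hcard ▸ h2)

/-- **Nechiporuk for `¬OV`**: any monotone formula for `¬OV_{n,d}` has `M n² ≤ 4 · size + 2`
(with `L, M` as above). [cite: arXiv260723799, Thm. 25(1)] -/
theorem mul_sq_le_size {L M : ℕ} (hL : 0 < L) (hLM : 2 * L + 2 * M ≤ d) (hnL : n < 2 ^ L)
    (h2 : 2 < 2 ^ (M * n)) (C : Circuit (Fin 2 × Fin n × Fin d)) (hO : C.IsOver monotoneBasis)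
    (hF : C.IsFormula) (hC : C.Computes (notOVFn n d)) :
    M * n ^ 2 ≤ 4 * C.size + 2 := by
  have hprod := C.prod_subfnMeasure_eval_le hO hF rowBlk
  have heval : C.eval = notOVFn n d := funext hC
  rw [heval] at hprod
  have hlow : (2 ^ (M * n)) ^ n ≤
      ∏ i₀ : Fin n, subfnMeasure {v | rowBlk v = some i₀} (notOVFn n d) := by
    calc (2 ^ (M * n)) ^ n = ∏ _i₀ : Fin n, 2 ^ (M * n) := by simp
      _ ≤ _ := prod_le_prod (fun _ _ => Nat.zero_le _)
          fun i₀ _ => pow_le_subfnMeasure_row hL hLM hnL h2 i₀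
  have hpow : 2 ^ (M * n ^ 2) ≤ 2 ^ (4 * C.size + 2) :=
    calc 2 ^ (M * n ^ 2) = (2 ^ (M * n)) ^ n := by rw [← pow_mul]; ring_nf
      _ ≤ 3 ^ (2 * C.size + 1) := hlow.trans hprod
      _ ≤ 4 ^ (2 * C.size + 1) := Nat.pow_le_pow_left (by norm_num) _
      _ = 2 ^ (4 * C.size + 2) := by
          rw [show (4 : ℕ) = 2 ^ 2 by norm_num, ← pow_mul]
          ring_nf
  exact (Nat.pow_le_pow_iff_right (by norm_num : 1 < 2)).1 hpow

/-- **The bound with explicit constants**: for `n ≥ 4` and `d ≥ 8 ⌊log₂ n⌋`,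
`n² d ≤ 32 · formulaSizeOver monotoneBasis (notOVFn n d)`. [cite: arXiv260723799, Thm. 25(1)] -/
theorem sq_mul_le_formulaSizeOver (hn : 4 ≤ n) (hd : 8 * Nat.log 2 n ≤ d) :
    n ^ 2 * d ≤ 32 * formulaSizeOver monotoneBasis (notOVFn n d) := by
  have hlog : 2 ≤ Nat.log 2 n := by
    have h4 : Nat.log 2 4 = 2 := by
      rw [show (4 : ℕ) = 2 ^ 2 by norm_num, Nat.log_pow (by norm_num : 1 < 2)]
    rw [← h4]
    exact Nat.log_mono_right hn
  set L := Nat.log 2 n + 1 with hLdef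
  set M := d / 2 - L with hMdef
  have hnL : n < 2 ^ L := Nat.lt_pow_succ_log_self one_lt_two n
  have hL : 0 < L := Nat.succ_pos _
  have hLM : 2 * L + 2 * M ≤ d := by omega
  have h4M : d ≤ 4 * M := by omega
  have hM4 : 4 ≤ M := by omega
  have hMn : 4 * 4 ≤ M * n := Nat.mul_le_mul hM4 hn
  have h2 : 2 < 2 ^ (M * n) :=
    calc 2 < 2 ^ 2 := by norm_num
      _ ≤ 2 ^ (M * n) := Nat.pow_le_pow_right two_pos (by omega)
  -- an optimal monotone formula exists
  obtain ⟨C₀, hO₀, hF₀, hC₀⟩ := exists_formula (n := n) (d := d) (by omega) (by omega)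
  have hmem : formulaSizeOver monotoneBasis (notOVFn n d) ∈
      {s | ∃ C : Circuit (Fin 2 × Fin n × Fin d),
        C.IsOver monotoneBasis ∧ C.IsFormula ∧ C.Computes (notOVFn n d) ∧ C.size = s} :=
    Nat.sInf_mem ⟨C₀.size, C₀, hO₀, hF₀, hC₀, rfl⟩
  obtain ⟨C, hO, hF, hC, hsize⟩ := hmem
  have key := mul_sq_le_size hL hLM hnL h2 C hO hF hC
  rw [hsize] at key
  have hMn2 : 4 * 16 ≤ M * n ^ 2 := Nat.mul_le_mul hM4 (by nlinarith)
  have e1 : n ^ 2 * d ≤ n ^ 2 * (4 * M) := Nat.mul_le_mul_left _ h4M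
  have e2 : n ^ 2 * (4 * M) = 4 * (M * n ^ 2) := by ring
  omega

end NotOV

/-- **fine-grained.S25, formula part — discharged.** Monotone formulas for `¬OV_{n,d}` have size
at least `n² d / 32` for all `n ≥ 4` and all `d ≥ 8 ⌊log₂ n⌋` (Choudhury–Limaye–Sreenivasaiah–
Srinivasan 2026, Thm. 25(1) / Thm. 6, whose binary-basis `Ω(n² d)` bound implies the monotone one;
proved here directly in the monotone basis by Nechiporuk's method). [cite: arXiv260723799, Thm. 25(1)] -/
theorem monotone_formula_notOV_lower_bound_holds : monotone_formula_notOV_lower_bound := by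
  refine ⟨1 / 32, by norm_num, 8, by norm_num, ?_⟩
  rw [Filter.eventually_atTop]
  refine ⟨4, fun n hn d hd => ?_⟩
  have h := NotOV.sq_mul_le_formulaSizeOver hn (by exact_mod_cast hd)
  have h' : ((n : ℝ) ^ 2 * d ≤ 32 * (formulaSizeOver monotoneBasis (notOVFn n d) : ℝ)) := by
    exact_mod_cast h
  linarith

end Literature.Computability.FineGrained
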